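import Summits.ValiantsHypothesis.ValiantsHypothesis.Theorems.DepthWindowNodeBias
import Mathlib.Data.Complex.Basic
import HarnessLib.Audit.Tags

/-!
# Route `DepthWindow` — the tree-bias bridge slope by slope (the `(2,1)` door consumes slope `2u`)

Cone-free helper (decomp-valiant lens 4, g13) supporting the crux item `HomImmHardTwoOne`
(stmt-ValiantsHypothesis-30635); companion of `DepthWindowNodeBias.lean`.  The proof of `treeBiasBridge`
(`DepthWindowTreeBiasBridge.lean`, g12) with its slope bookkeeping exposed: with the unrolling constant `u`
named (`HomUnrollWith u`; `HomUnroll ↔ ∃ u, HomUnrollWith u`), depth-preserving set-multilinearisation and the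
tree-bias bound for set-multilinear `IMM` formulas turn the slope slice `TreeBiasGrowthAt (u·p)` into
`HomImmHardAt p q` (spelled verbatim, as in `DepthWindowTreeBiasBridge`).  Hence the crux cell `(2,1)` consumes
exactly `TreeBiasGrowthAt (2u)` (`homImmHardAt_two_one_of_treeBiasAt`), and under the universal low-bias
conjecture `ULB_C` with `C ≤ 2u` — in particular under `ULB_2`, for every `u ≥ 1` — that input is FALSE
(`treeBiasDoor_closed_of_ULB`, `treeBiasDoor_closed_of_ULB_two`, from `not_treeBiasGrowthAt_of_ULB`): the
barrier form of the last typed door into the A-cell.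

References: [LimayeSrinivasanTavenas2022] CCC 2022 (LIPIcs 234:32) Thm. 3; [LimayeSrinivasanTavenas2025]
Lemma 12; [Burgisser2000] §2.1; [BhargavDuttaSaxena2024] Thm. 1.7.
-/

-- layout Summits/ValiantsHypothesis/ValiantsHypothesis forces the duplicated namespace component
set_option linter.dupNamespace false

namespace Summit.ValiantsHypothesis.ValiantsHypothesis.Theorems.DepthWindow.TreeBias

open Finset MvPolynomial Literature.Computability.AlgebraicComplexity ArithCircuit
open Summit.ValiantsHypothesis.ValiantsHypothesis.Theorems.DepthWindow.Riffle

/-! ### The bridge slope by slope -/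

/-- **Unrolling with a named depth constant `u`** (the body of `Riffle.HomUnroll` with its existential
constant exposed): every-gate-homogeneous circuit of product-depth `Γ` ↦ every-gate-homogeneous formula of
product-depth `≤ u(Γ+1)` and edge size `≤ (s + |σ| + d + 2)^{u(Γ+1)}`.  Print (folklore); unported.
[cite: Burgisser2000, §2.1] -/
@[conjecture] def HomUnrollWith (u : ℕ) : Prop :=
  ∀ (σ : Type) [Fintype σ] [DecidableEq σ] (d Γ : ℕ) (f : MvPolynomial σ ℂ),
    f.IsHomogeneous d → ∀ D : ArithCircuit ℂ σ,
      (∀ g ∈ gateValues D.gates, ∃ e : ℕ, g.IsHomogeneous e) → D.Computes f → D.productDepth ≤ Γ →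
      ∃ P : ArithCircuit ℂ σ, P.IsFormula ∧ (∀ g ∈ gateValues P.gates, ∃ e : ℕ, g.IsHomogeneous e) ∧
        P.Computes f ∧ P.productDepth ≤ u * (Γ + 1) ∧
        P.edgeSize ≤ (D.size + Fintype.card σ + d + 2) ^ (u * (Γ + 1))

/-- `HomUnroll ↔ ∃ u, HomUnrollWith u` (definitional). [folklore] -/
theorem homUnroll_iff : HomUnroll ↔ ∃ u, HomUnrollWith u := Iff.rfl

/-- A sum of at most `5` terms each `≤ m^e` is `≤ m^(e+1)` once `m ≥ 5`. [folklore] -/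
private theorem sum5_le_pow_succ {m e x₁ x₂ x₃ x₄ x₅ : ℕ} (hm : 5 ≤ m) (h₁ : x₁ ≤ m ^ e) (h₂ : x₂ ≤ m ^ e)
    (h₃ : x₃ ≤ m ^ e) (h₄ : x₄ ≤ m ^ e) (h₅ : x₅ ≤ m ^ e) : x₁ + x₂ + x₃ + x₄ + x₅ ≤ m ^ (e + 1) := by
  calc x₁ + x₂ + x₃ + x₄ + x₅ ≤ 5 * m ^ e := by omega
    _ ≤ m * m ^ e := Nat.mul_le_mul_right _ hm
    _ = m ^ (e + 1) := by ring

/-- `2^(x·e) ≤ m^x` whenever `e ≤ ⌊log₂ m⌋` and `m ≠ 0`. [folklore] -/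
private theorem two_pow_mul_le_pow {x e m : ℕ} (hm : m ≠ 0) (he : e ≤ Nat.log 2 m) :
    2 ^ (x * e) ≤ m ^ x := by
  calc 2 ^ (x * e) ≤ 2 ^ (x * Nat.log 2 m) := Nat.pow_le_pow_right (by norm_num) (Nat.mul_le_mul_left x he)
    _ = (2 ^ Nat.log 2 m) ^ x := by rw [mul_comm, pow_mul]
    _ ≤ m ^ x := Nat.pow_le_pow_left (Nat.pow_log_le_self 2 hm) x

/-- `d^(3d) ≤ m^3` when `d·d ≤ ⌊log₂ m⌋` and `m ≠ 0` (`d ≤ 2^d`). [folklore] -/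
private theorem pow_three_mul_le {d m : ℕ} (hm : m ≠ 0) (hdd : d * d ≤ Nat.log 2 m) :
    d ^ (3 * d) ≤ m ^ 3 := by
  calc d ^ (3 * d) ≤ (2 ^ d) ^ (3 * d) := Nat.pow_le_pow_left (Nat.lt_two_pow_self).le _
    _ = 2 ^ (3 * (d * d)) := by rw [← pow_mul]; ring_nf
    _ ≤ m ^ 3 := two_pow_mul_le_pow hm hdd

/-- `m^x ≤ 2^(2·⌊log₂ m⌋·x)` for `m ≥ 2`. [folklore] -/
private theorem pow_lt_two_pow {m x : ℕ} (hm : 2 ≤ m) : m ^ x ≤ 2 ^ (2 * Nat.log 2 m * x) := by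
  have h1 : m < 2 ^ (Nat.log 2 m + 1) := Nat.lt_pow_succ_log_self (by norm_num) m
  have hL : 1 ≤ Nat.log 2 m := Nat.le_log_of_pow_le (by norm_num) (by simpa using hm)
  calc m ^ x ≤ (2 ^ (Nat.log 2 m + 1)) ^ x := Nat.pow_le_pow_left h1.le x
    _ = 2 ^ ((Nat.log 2 m + 1) * x) := by rw [← pow_mul]
    _ ≤ 2 ^ (2 * Nat.log 2 m * x) :=
        Nat.pow_le_pow_right (by norm_num) (Nat.mul_le_mul_right x (by omega))

/-- **The tree-bias bridge at one slope** (the proof of `treeBiasBridge`, with the slope bookkeeping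
exposed): unrolling with depth constant `u`, depth-preserving set-multilinearisation and the tree-bias bound
for set-multilinear `IMM` formulas turn `TreeBiasGrowthAt (u·p)` into homogeneous `IMM` hardness at depth
`⌊p·L₃/q⌋ + c` — the statement `HomImmHardAt p q` of `DepthWindowSlopeRate`, spelled verbatim.  The cell
`(2,1)` of the route therefore consumes `TreeBiasGrowthAt (2u)`, nothing at lower slope.
[cite: LimayeSrinivasanTavenas2022, Thm. 3] [cite: LimayeSrinivasanTavenas2025, Lemma 12]
[cite: Burgisser2000, §2.1] -/
theorem treeBiasBridgeAt {u : ℕ} (hU : HomUnrollWith u) (hS : SmlizeFormulaDepth) (hT : TreeBiasImmFormula)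
    {p : ℕ} (hG : TreeBiasGrowthAt (u * p)) (q : ℕ) :
    ∀ c : ℕ, ∃ m₀ : ℕ, ∀ m : ℕ, m₀ ≤ m →
      ∀ D : ArithCircuit ℂ (Fin (Nat.sqrt (Nat.log 2 m)) × Fin m × Fin m),
        (∀ g ∈ ArithCircuit.gateValues D.gates, ∃ e : ℕ, g.IsHomogeneous e) →
        D.Computes (immPoly m (Nat.sqrt (Nat.log 2 m)) ℂ) →
        D.productDepth ≤ p * Nat.log 2 (Nat.log 2 (Nat.log 2 m)) / q + c → m ^ c + c < D.size := by
  intro c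
  obtain ⟨a, hS⟩ := hS
  -- constants: edge size of the set-multilinear formula ≤ m^(K₁ Δ₁ + K₀), Δ₁ = u (Γ+1)
  obtain ⟨K₁, hK₁⟩ : ∃ K₁ : ℕ, K₁ = a * (c + 5) := ⟨_, rfl⟩
  obtain ⟨K₀, hK₀⟩ : ∃ K₀ : ℕ, K₀ = 5 * a + 1 := ⟨_, rfl⟩
  obtain ⟨m₀, hG'⟩ := hG (u * (c + 1)) (2 * K₁ + 2 * K₀ + 8)
  refine ⟨max m₀ (max (2 ^ 2 ^ 4) (max c 5)), fun m hm => ?_⟩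
  -- thresholds
  have hmm₀ : m₀ ≤ m := le_trans (le_max_left _ _) hm
  have hmJ : 2 ^ 2 ^ 4 ≤ m := le_trans (le_trans (le_max_left _ _) (le_max_right _ _)) hm
  have hmc5 : max c 5 ≤ m := le_trans (le_trans (le_max_right _ _) (le_max_right _ _)) hm
  have hmc : c ≤ m := le_trans (le_max_left _ _) hmc5
  have hm5 : 5 ≤ m := le_trans (le_max_right _ _) hmc5
  have hm0 : m ≠ 0 := by omega
  have hL₁J : 2 ^ 4 ≤ Nat.log 2 m := Nat.le_log_of_pow_le (by norm_num) hmJ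
  have hL₁1 : 1 ≤ Nat.log 2 m := le_trans (by norm_num) hL₁J
  -- the conjecture instance at this `m`
  have hGm := hG' m hmm₀
  -- facts about d = ⌊√L₁⌋ before generalising it
  have hdd : Nat.sqrt (Nat.log 2 m) * Nat.sqrt (Nat.log 2 m) ≤ Nat.log 2 m := Nat.sqrt_le _
  have hdm : Nat.sqrt (Nat.log 2 m) ≤ m := (Nat.sqrt_le_self _).trans (Nat.log_le_self 2 m)
  have hd4 : 4 ≤ Nat.sqrt (Nat.log 2 m) := by
    rw [Nat.le_sqrt]; exact le_trans (by norm_num) hL₁J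
  generalize hdg : Nat.sqrt (Nat.log 2 m) = d at hdd hdm hd4 hGm ⊢
  generalize hjg : Nat.log 2 (Nat.log 2 m) = j at hGm ⊢
  intro D hhom hD hpd
  -- generalise the depth budget Γ := ⌊p log₂ j / q⌋ + c ≤ p log₂ j + c
  have hΓle : p * Nat.log 2 j / q + c ≤ p * Nat.log 2 j + c := by
    have : p * Nat.log 2 j / q ≤ p * Nat.log 2 j := Nat.div_le_self _ _
    omega
  generalize hΓg : p * Nat.log 2 j / q + c = Γ at hpd hΓle
  -- Δmax := u p log₂ j + u (c+1) + 1 ≥ u (Γ+1) + 1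
  have hΔ₁ : u * (Γ + 1) ≤ u * p * Nat.log 2 j + u * (c + 1) := by
    calc u * (Γ + 1) ≤ u * (p * Nat.log 2 j + c + 1) := Nat.mul_le_mul_left _ (by omega)
      _ = u * p * Nat.log 2 j + u * (c + 1) := by ring
  generalize hMg : u * p * Nat.log 2 j + u * (c + 1) = M at hGm hΔ₁
  -- by contradiction: a small circuit
  by_contra hsize
  rw [not_lt] at hsize
  -- (1) unroll
  have hfhom : (immPoly m d ℂ).IsHomogeneous d := immPoly_isHomogeneous_holds (k := ℂ) m d
  obtain ⟨P₁, hP₁F, hP₁hom, hP₁c, hP₁pd, hP₁E⟩ :=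
    hU (Fin d × Fin m × Fin m) d Γ (immPoly m d ℂ) hfhom D hhom hD hpd
  -- (2) set-multilinearise (depth-preserving)
  obtain ⟨P₂, hP₂sml, hP₂c, hP₂pd, hP₂E⟩ :=
    hS (Fin d × Fin m × Fin m) (Fin d) Prod.fst (immPoly m d ℂ) (isSetMultilinear_immPoly m d)
      P₁ hP₁F hP₁hom hP₁c
  -- (3) the word at depth Δ* := max 1 (productDepth P₂) ≤ M + 1 and the tree-bias bound
  have hΔst : max 1 P₂.productDepth ≤ M + 1 := by
    have : P₂.productDepth ≤ M := hP₂pd.trans (hP₁pd.trans hΔ₁)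
    omega
  obtain ⟨sz, pos, hsz, hfit, hTB⟩ := hGm (max 1 P₂.productDepth) hΔst
  have hlow := hT m d (max 1 P₂.productDepth) _ sz pos (le_max_left _ _) hsz hfit hTB P₂ hP₂sml hP₂c
    (le_max_right _ _)
  rw [Nat.mul_div_cancel_left _ (by norm_num : 0 < 2)] at hlow
  -- (4) the upper bound  E₂ + 1 ≤ m^(K₁ u(Γ+1) + K₀)
  have hcard : Fintype.card (Fin d × Fin m × Fin m) = d * (m * m) := by simp [Fintype.card_prod]
  have hcardι : Fintype.card (Fin d) = d := Fintype.card_fin d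
  have hmpow : ∀ e, 1 ≤ e → m ≤ m ^ e := fun e he =>
    (pow_one m).symm.le.trans (Nat.pow_le_pow_right (by omega) he)
  have hmpos : ∀ e, 1 ≤ m ^ e := fun e => Nat.one_le_pow _ _ (by omega)
  have hX : D.size + Fintype.card (Fin d × Fin m × Fin m) + d + 2 ≤ m ^ (c + 4) := by
    rw [hcard]
    have e1 : m ^ c ≤ m ^ (c + 3) := Nat.pow_le_pow_right (by omega) (by omega)
    have e2 : c ≤ m ^ (c + 3) := le_trans hmc (hmpow _ (by omega))
    have e3 : d * (m * m) ≤ m ^ (c + 3) := (Nat.mul_le_mul_right _ hdm).trans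
      ((show m * (m * m) = m ^ 3 by ring).le.trans (Nat.pow_le_pow_right (by omega) (by omega)))
    have e4 : d ≤ m ^ (c + 3) := le_trans hdm (hmpow _ (by omega))
    have e5 : 2 ≤ m ^ (c + 3) := le_trans (by omega : 2 ≤ m) (hmpow _ (by omega))
    have h5 := sum5_le_pow_succ (e := c + 3) hm5 e1 e2 e3 e4 e5
    have hs : D.size ≤ m ^ c + c := hsize
    have h34 : m ^ (c + 3 + 1) = m ^ (c + 4) := rfl
    omega
  have hE₁ : P₁.edgeSize ≤ m ^ ((c + 4) * (u * (Γ + 1))) := by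
    calc P₁.edgeSize ≤ (D.size + Fintype.card (Fin d × Fin m × Fin m) + d + 2) ^ (u * (Γ + 1)) := hP₁E
      _ ≤ (m ^ (c + 4)) ^ (u * (Γ + 1)) := Nat.pow_le_pow_left hX _
      _ = m ^ ((c + 4) * (u * (Γ + 1))) := by rw [← pow_mul]
  generalize hW₁g : (c + 4) * (u * (Γ + 1)) = W₁ at hE₁
  have hY : P₁.edgeSize + Fintype.card (Fin d × Fin m × Fin m) + 2 ≤ m ^ (W₁ + 4) := by
    rw [hcard]
    have e1 : P₁.edgeSize ≤ m ^ (W₁ + 3) := le_trans hE₁ (Nat.pow_le_pow_right (by omega) (by omega))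
    have e3 : d * (m * m) ≤ m ^ (W₁ + 3) := (Nat.mul_le_mul_right _ hdm).trans
      ((show m * (m * m) = m ^ 3 by ring).le.trans (Nat.pow_le_pow_right (by omega) (by omega)))
    have e5 : 2 ≤ m ^ (W₁ + 3) := le_trans (by omega : 2 ≤ m) (hmpow _ (by omega))
    have h5 := sum5_le_pow_succ (x₄ := 0) (x₅ := 0) hm5 e1 e3 e5 (Nat.zero_le _) (Nat.zero_le _)
    have h34 : m ^ (W₁ + 3 + 1) = m ^ (W₁ + 4) := rfl
    omega
  have h2pow : 2 ^ (a * Fintype.card (Fin d) * Fintype.card (Fin d) * (P₁.productDepth + 1)) ≤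
      m ^ (a * (u * (Γ + 1) + 1)) := by
    rw [hcardι]
    have hmono : a * d * d * (P₁.productDepth + 1) ≤ a * (u * (Γ + 1) + 1) * (d * d) := by
      have : P₁.productDepth + 1 ≤ u * (Γ + 1) + 1 := by omega
      calc a * d * d * (P₁.productDepth + 1) ≤ a * d * d * (u * (Γ + 1) + 1) :=
          Nat.mul_le_mul_left _ this
        _ = a * (u * (Γ + 1) + 1) * (d * d) := by ring
    calc 2 ^ (a * d * d * (P₁.productDepth + 1)) ≤ 2 ^ (a * (u * (Γ + 1) + 1) * (d * d)) :=
          Nat.pow_le_pow_right (by norm_num) hmono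
      _ ≤ m ^ (a * (u * (Γ + 1) + 1)) := two_pow_mul_le_pow hm0 hdd
  have hle : a * (W₁ + 4) + a * (u * (Γ + 1) + 1) + 1 ≤ K₁ * (u * (Γ + 1)) + K₀ := by
    rw [← hW₁g, hK₁, hK₀]; ring_nf; omega
  have hE₂ : P₂.edgeSize + 1 ≤ m ^ (K₁ * (u * (Γ + 1)) + K₀) := by
    have h1 : P₂.edgeSize ≤ m ^ (a * (W₁ + 4) + a * (u * (Γ + 1) + 1)) := by
      calc P₂.edgeSize ≤ (P₁.edgeSize + Fintype.card (Fin d × Fin m × Fin m) + 2) ^ a *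
            2 ^ (a * Fintype.card (Fin d) * Fintype.card (Fin d) * (P₁.productDepth + 1)) := hP₂E
        _ ≤ (m ^ (W₁ + 4)) ^ a * m ^ (a * (u * (Γ + 1) + 1)) :=
            Nat.mul_le_mul (Nat.pow_le_pow_left hY _) h2pow
        _ = m ^ (a * (W₁ + 4) + a * (u * (Γ + 1) + 1)) := by
            rw [← pow_mul, ← pow_add, mul_comm (W₁ + 4)]
    generalize hVg : a * (W₁ + 4) + a * (u * (Γ + 1) + 1) = V at h1 hle
    have h2 : m ^ V + 1 ≤ m ^ (V + 1) := by
      calc m ^ V + 1 ≤ m ^ V + m ^ V := Nat.add_le_add_left (hmpos _) _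
        _ = 2 * m ^ V := by ring
        _ ≤ m * m ^ V := Nat.mul_le_mul_right _ (by omega)
        _ = m ^ (V + 1) := by ring
    have h3 : m ^ (V + 1) ≤ m ^ (K₁ * (u * (Γ + 1)) + K₀) := Nat.pow_le_pow_right (by omega) hle
    omega
  -- (5) d^(3d)(E₂+1) ≤ m^(3 + K₁ Δ₁ + K₀) ≤ 2^(2 log₂ m (3 + K₁ M + K₀)) < 2^(C (M+2) log₂ m)
  have hup : d ^ (3 * d) * (P₂.edgeSize + 1) ≤ 2 ^ (2 * Nat.log 2 m * (3 + K₁ * M + K₀)) := by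
    calc d ^ (3 * d) * (P₂.edgeSize + 1) ≤ m ^ 3 * m ^ (K₁ * (u * (Γ + 1)) + K₀) :=
          Nat.mul_le_mul (pow_three_mul_le hm0 hdd) hE₂
      _ = m ^ (3 + (K₁ * (u * (Γ + 1)) + K₀)) := (pow_add _ _ _).symm
      _ ≤ m ^ (3 + K₁ * M + K₀) := Nat.pow_le_pow_right (by omega)
          (by have := Nat.mul_le_mul_left K₁ hΔ₁; omega)
      _ ≤ 2 ^ (2 * Nat.log 2 m * (3 + K₁ * M + K₀)) := pow_lt_two_pow (by omega)
  have hexp : 2 * Nat.log 2 m * (3 + K₁ * M + K₀) < (2 * K₁ + 2 * K₀ + 8) * (M + 2) * Nat.log 2 m := by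
    have h0 : (2 * K₁ + 2 * K₀ + 8) * (M + 2) =
        2 * (K₁ * M) + 2 * (K₀ * M) + 8 * M + 4 * K₁ + 4 * K₀ + 16 := by ring
    have h1 : 2 * (3 + K₁ * M + K₀) < (2 * K₁ + 2 * K₀ + 8) * (M + 2) := by rw [h0]; omega
    calc 2 * Nat.log 2 m * (3 + K₁ * M + K₀) = (2 * (3 + K₁ * M + K₀)) * Nat.log 2 m := by ring
      _ < (2 * K₁ + 2 * K₀ + 8) * (M + 2) * Nat.log 2 m := Nat.mul_lt_mul_of_pos_right h1 (by omega)
  have hlt : 2 ^ (2 * Nat.log 2 m * (3 + K₁ * M + K₀)) <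
      2 ^ ((2 * K₁ + 2 * K₀ + 8) * (M + 2) * Nat.log 2 m) := Nat.pow_lt_pow_right (by norm_num) hexp
  omega

/-- **The `(2,1)` door, slope-exact.**  With unrolling constant `u`, the tree-bias door to the crux
`HomImmHardTwoOne` (`= HomImmHardAt 2 1`, verbatim below) needs exactly `TreeBiasGrowthAt (2u)`.
[cite: LimayeSrinivasanTavenas2022, Thm. 3] -/
theorem homImmHardAt_two_one_of_treeBiasAt {u : ℕ} (hU : HomUnrollWith u) (hS : SmlizeFormulaDepth)
    (hT : TreeBiasImmFormula) (hG : TreeBiasGrowthAt (u * 2)) :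
    ∀ c : ℕ, ∃ m₀ : ℕ, ∀ m : ℕ, m₀ ≤ m →
      ∀ D : ArithCircuit ℂ (Fin (Nat.sqrt (Nat.log 2 m)) × Fin m × Fin m),
        (∀ g ∈ ArithCircuit.gateValues D.gates, ∃ e : ℕ, g.IsHomogeneous e) →
        D.Computes (immPoly m (Nat.sqrt (Nat.log 2 m)) ℂ) →
        D.productDepth ≤ 2 * Nat.log 2 (Nat.log 2 (Nat.log 2 m)) / 1 + c → m ^ c + c < D.size :=
  treeBiasBridgeAt hU hS hT hG 1

/-- **Barrier form of the door.**  Under `ULB_C` with `C ≤ 2u` the slope the `(2,1)` door consumes is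
refuted: the door's problem-side input `TreeBiasGrowthAt (u·2)` is FALSE.  In particular `ULB_2` closes the
door for every unrolling constant `u ≥ 1`. [cite: LimayeSrinivasanTavenas2022, Prop. 17]
[cite: BhargavDuttaSaxena2024, Thm. 1.7] -/
theorem treeBiasDoor_closed_of_ULB {C u : ℕ} (hU : UniversalLowBiasAt C) (hCu : C ≤ u * 2) :
    ¬ TreeBiasGrowthAt (u * 2) :=
  not_treeBiasGrowthAt_of_ULB hU hCu

/-- The instance that matters: `ULB_2 ⇒ ¬ TreeBiasGrowthAt (2u)` for every `u ≥ 1`. [folklore] -/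
theorem treeBiasDoor_closed_of_ULB_two {u : ℕ} (hu : 1 ≤ u) (hU : UniversalLowBiasAt 2) :
    ¬ TreeBiasGrowthAt (u * 2) :=
  treeBiasDoor_closed_of_ULB hU (by omega)

end Summit.ValiantsHypothesis.ValiantsHypothesis.Theorems.DepthWindow.TreeBias
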